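import Mathlib
import Summits.NavierStokesRegularity.NavierStokesRegularity.Theorems.TaoLadderRungTwoBreakOneShiftWindowRTermD
import HarnessLib

/-!
# The one-shift window system, XXXb: SOUNDNESS OF THE TERM-DATA LAYER — the derived sparse quadratic rows present
# the homogenised centre / rough fields, the field-deviation rows bound `|F_t − F_c|`, the Jacobian rows enclose
# `∂_j F_c` (cell harvest/h2-tao-ladder, seat p2; rung1/KERNEL-CHEAP-REPLAY-SPEC.md §1, §2 (d), §7 «CHECKER» (d);
# support for K1(1) = `NoSurvivingDSSOne`, stmt-NavierStokesRegularity-20205)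

MODEL lattice ODEs only (Tao 2016 §4 normal form on Tao's shift set `S`); nothing here is a statement about
the Navier–Stokes equations; no item is closed; nothing numerical is certified. Generic in `ι` (numbered by
`e : ι ≃ Fin n`) and `κ`. Part XXX (`…RTermD.lean`) defines the data format `RTermD`/`RRows`, the derived
executable data `sqC`/`sqR`/`cbRow`/`jacRow` and the real-side relation `IsRTEncl e Tc Tt rows RD`; here:

* `isSQEnclosure_sqC` : `IsSQEnclosure (homQ Tc e) (sqC n prec RD)` and `isSQEnclosure_sqR` :
  `IsSQEnclosure (homQ Tt e) (sqR n prec RD)` — so parts XXVI–XXVIII (interval jets, centre step) apply to the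
  centre field and to every rough realisation;
* `abs_termField_sub_le_cbRow` — `|termField Tt x i − termField Tc x i| ≤ mag (cbRow prec X (rrow RD (e i)))` on
  the box (the `cb` of parts XVII/XXIX);
* `mem_jacEntry_jacRow` — `jacEntry Tc x i j ∈ jacRow prec X (e j) (rrow RD (e i))` on the box (the `dg`/`R` of
  parts XVI/XVII/XXIX).
-/

-- the sub-problem namespace repeats the summit name by design (D-0017)
set_option linter.dupNamespace false

namespace Summit.NavierStokesRegularity.NavierStokesRegularity.Theorems

namespace DSSOneShift

open Set Finset
open Summit.NavierStokesRegularity.NavierStokesRegularity.Theorems.TaylorModelCert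
open Summit.NavierStokesRegularity.NavierStokesRegularity.Theorems.TaylorModelReadout
open Summit.NavierStokesRegularity.NavierStokesRegularity.Theorems.CertificateGlueOn

variable {ι : Type*} [Fintype ι] [DecidableEq ι] {κ : Type*} [Fintype κ] {n : ℕ}

/-! ### Soundness of the derived data -/

section RowSound

variable (e : ι ≃ Fin n) {Tc Tt : κ → BTerm ι}

omit [Fintype ι] [DecidableEq ι] [Fintype κ] in
/-- Centre rows: a decorated row matching `sqRowC` whose bilinear functional is the list sum of the homogenised
centre terms. [folklore] -/
theorem exists_dec_sqRowC (prec : ℕ) :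
    ∀ {dl : List RTermD} {kl : List κ}, List.Forall₂ (fun d k => TermOK e d (Tc k) (Tt k)) dl kl →
      ∃ σ : List (ℝ × ℕ × ℕ), SQRowOK (n + 1) σ (sqRowC n prec dl) ∧ ∀ u w : Fin (n + 1) → ℝ,
        (kl.map fun k => (Tc k).coef * ((Tc k).fa.hval e u * (Tc k).fb.hval e w)).sum = sqRowVal σ (rdN u) (rdN w)
  | _, _, List.Forall₂.nil => ⟨[], List.Forall₂.nil, fun u w => by simp⟩
  | _, _, List.Forall₂.cons (a := d) (b := k) h hl => by
    obtain ⟨σ, hσ, hval⟩ := exists_dec_sqRowC prec hl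
    obtain ⟨hq, -, hfa, hfb⟩ := h
    obtain ⟨ma, _mta, hma, _hmta, hia, hfa'⟩ := mul_of_facOK e hfa
    obtain ⟨mb, _mtb, hmb, _hmtb, hib, hfb'⟩ := mul_of_facOK e hfb
    refine ⟨((Tc k).coef * ma * mb, d.2.1.hidx n, d.2.2.hidx n) :: σ, List.Forall₂.cons ⟨?_, rfl, hia, hib⟩ hσ,
      fun u w => ?_⟩
    · exact IntervalD.mem_mulR prec (IntervalD.mem_mulR prec hq hma) hmb
    · rw [List.map_cons, List.sum_cons, sqRowVal_cons, hval u w, (hfa' u).1, (hfb' w).1]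
      ring

omit [Fintype ι] [DecidableEq ι] [Fintype κ] in
/-- Rough rows: the same for `sqRowR` and the rough terms. [folklore] -/
theorem exists_dec_sqRowR (prec : ℕ) :
    ∀ {dl : List RTermD} {kl : List κ}, List.Forall₂ (fun d k => TermOK e d (Tc k) (Tt k)) dl kl →
      ∃ σ : List (ℝ × ℕ × ℕ), SQRowOK (n + 1) σ (sqRowR n prec dl) ∧ ∀ u w : Fin (n + 1) → ℝ,
        (kl.map fun k => (Tt k).coef * ((Tt k).fa.hval e u * (Tt k).fb.hval e w)).sum = sqRowVal σ (rdN u) (rdN w)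
  | _, _, List.Forall₂.nil => ⟨[], List.Forall₂.nil, fun u w => by simp⟩
  | _, _, List.Forall₂.cons (a := d) (b := k) h hl => by
    obtain ⟨σ, hσ, hval⟩ := exists_dec_sqRowR prec hl
    obtain ⟨hq, hcoef, hfa, hfb⟩ := h
    obtain ⟨_mca, ma, _hmca, hma, hia, hfa'⟩ := mul_of_facOK e hfa
    obtain ⟨_mcb, mb, _hmcb, hmb, hib, hfb'⟩ := mul_of_facOK e hfb
    refine ⟨((Tt k).coef * ma * mb, d.2.1.hidx n, d.2.2.hidx n) :: σ, List.Forall₂.cons ⟨?_, rfl, hia, hib⟩ hσ,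
      fun u w => ?_⟩
    · rw [hcoef]; exact IntervalD.mem_mulR prec (IntervalD.mem_mulR prec hq hma) hmb
    · rw [List.map_cons, List.sum_cons, sqRowVal_cons, hval u w, (hfa' u).2, (hfb' w).2]
      ring

omit [Fintype ι] in
/-- **The derived centre rows present the homogenised centre field.** [cite: Moore1979, §3.2; cell vocabulary, harvest/h2-tao-ladder rung1/KERNEL-CHEAP-REPLAY-SPEC.md §1] -/
theorem isSQEnclosure_sqC {rows : ι → List κ} {RD : RRows} (h : IsRTEncl e Tc Tt rows RD) (prec : ℕ) :
    IsSQEnclosure (homQ Tc e) (sqC n prec RD) := by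
  intro c
  induction c using Fin.lastCases with
  | last =>
    refine ⟨[], ?_, fun u w => by rw [homQ_last, sqRowVal_nil]⟩
    unfold sqC; rw [Fin.val_last, sqRow_ofFn _ (Nat.lt_succ_self n)]
    simp only [lt_irrefl, if_false]
    exact List.Forall₂.nil
  | cast c =>
    obtain ⟨hrows, -, hdata⟩ := h
    obtain ⟨σ, hσ, hval⟩ := exists_dec_sqRowC e prec (hdata (e.symm c))
    refine ⟨σ, ?_, fun u w => ?_⟩
    · unfold sqC; rw [Fin.val_castSucc, sqRow_ofFn _ (Nat.lt_succ_of_lt c.isLt)]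
      simp only [c.isLt, if_true]
      simpa using hσ
    · rw [homQ_castSucc]
      simp only [mul_assoc]
      rw [hrows (e.symm c)]
      exact hval u w

omit [Fintype ι] in
/-- **The derived rough rows present the homogenised rough field** (every realisation within the tubes). [cite: Moore1979, §3.2; cell vocabulary, harvest/h2-tao-ladder rung1/KERNEL-CHEAP-REPLAY-SPEC.md §1 (tube)] -/
theorem isSQEnclosure_sqR {rows : ι → List κ} {RD : RRows} (h : IsRTEncl e Tc Tt rows RD) (prec : ℕ) :
    IsSQEnclosure (homQ Tt e) (sqR n prec RD) := by
  intro c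
  induction c using Fin.lastCases with
  | last =>
    refine ⟨[], ?_, fun u w => by rw [homQ_last, sqRowVal_nil]⟩
    unfold sqR; rw [Fin.val_last, sqRow_ofFn _ (Nat.lt_succ_self n)]
    simp only [lt_irrefl, if_false]
    exact List.Forall₂.nil
  | cast c =>
    obtain ⟨hrows, hsame, hdata⟩ := h
    obtain ⟨σ, hσ, hval⟩ := exists_dec_sqRowR e prec (hdata (e.symm c))
    refine ⟨σ, ?_, fun u w => ?_⟩
    · unfold sqR; rw [Fin.val_castSucc, sqRow_ofFn _ (Nat.lt_succ_of_lt c.isLt)]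
      simp only [c.isLt, if_true]
      simpa using hσ
    · have hrowsT : ∑ k, (Tt k).coefAt (e.symm c) * ((Tt k).fa.hval e u * (Tt k).fb.hval e w) =
          ((rows (e.symm c)).map fun k => (Tt k).coef * ((Tt k).fa.hval e u * (Tt k).fb.hval e w)).sum := by
        rw [show (fun k => (Tt k).coef * ((Tt k).fa.hval e u * (Tt k).fb.hval e w)) =
            (fun k => (Tc k).coef * ((Tt k).fa.hval e u * (Tt k).fb.hval e w)) from
            funext fun k => by rw [(hsame k).2]]
        rw [← hrows (e.symm c)]
        exact Finset.sum_congr rfl fun k _ => by rw [coefAt_eq_of_same hsame]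
      rw [homQ_castSucc]
      simp only [mul_assoc]
      rw [hrowsT]
      exact hval u w

/-! ### Field deviation and centre Jacobian over a box -/

omit [Fintype ι] [DecidableEq ι] [Fintype κ] in
/-- One row of the field deviation lies in `cbRow`. [folklore] -/
theorem mem_cbRow (prec : ℕ) {X : Array IntervalD} {x : ι → ℝ} (hx : ∀ i, IntervalD.mem (x i) (IntervalD.aget X (e i))) :
    ∀ {dl : List RTermD} {kl : List κ}, List.Forall₂ (fun d k => TermOK e d (Tc k) (Tt k)) dl kl →
      IntervalD.mem ((kl.map fun k => (Tc k).coef * ((Tt k).fa.val x * (Tt k).fb.val x - (Tc k).fa.val x * (Tc k).fb.val x)).sum)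
        (cbRow prec X dl)
  | _, _, List.Forall₂.nil => by simpa [cbRow] using IntervalD.mem_ofInt 0
  | _, _, List.Forall₂.cons (a := d) (b := k) h hl => by
    obtain ⟨hq, -, hfa, hfb⟩ := h
    obtain ⟨hac, -, had⟩ := mem_vals e hfa (X := X) hx
    obtain ⟨-, hbt, hbd⟩ := mem_vals e hfb (X := X) hx
    rw [List.map_cons, List.sum_cons, cbRow]
    refine IntervalD.mem_addR prec ?_ (mem_cbRow prec hx hl)
    have e1 : (Tc k).coef * ((Tt k).fa.val x * (Tt k).fb.val x - (Tc k).fa.val x * (Tc k).fb.val x) =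
        (Tc k).coef * (((Tt k).fa.val x - (Tc k).fa.val x) * (Tt k).fb.val x +
          (Tc k).fa.val x * ((Tt k).fb.val x - (Tc k).fb.val x)) := by ring
    rw [e1]
    exact IntervalD.mem_mulR prec hq (IntervalD.mem_addR prec (IntervalD.mem_mulR prec had hbt)
      (IntervalD.mem_mulR prec hac hbd))

omit [Fintype ι] in
/-- **THE FIELD DEVIATION BOUND**: for `x` in the box `X` (read through `e`),
`|termField Tt x i − termField Tc x i| ≤ mag (cbRow prec X (rrow RD (e i)))` — the `cb` of parts XVII/XXIX.
[cite: KapelaZgliczynski2009, §4 (perturbation size); cell vocabulary, harvest/h2-tao-ladder rung1/KERNEL-CHEAP-REPLAY-SPEC.md §2 (d) (inclusion half-widths)] -/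
theorem abs_termField_sub_le_cbRow {rows : ι → List κ} {RD : RRows} (h : IsRTEncl e Tc Tt rows RD) (prec : ℕ)
    {X : Array IntervalD} {x : ι → ℝ} (hx : ∀ i, IntervalD.mem (x i) (IntervalD.aget X (e i))) (i : ι) :
    |termField Tt x i - termField Tc x i| ≤ (IntervalD.mag (cbRow prec X (rrow RD (e i)))).toReal := by
  obtain ⟨hrows, hsame, hdata⟩ := h
  refine IntervalD.abs_le_mag ?_
  have hdiff : termField Tt x i - termField Tc x i =
      ((rows i).map fun k => (Tc k).coef * ((Tt k).fa.val x * (Tt k).fb.val x - (Tc k).fa.val x * (Tc k).fb.val x)).sum := by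
    rw [termField, termField, ← Finset.sum_sub_distrib, ← hrows i]
    refine Finset.sum_congr rfl fun k _ => ?_
    rw [coefAt_eq_of_same hsame]; ring
  rw [hdiff]
  exact mem_cbRow e prec hx (hdata i)

omit [Fintype ι] [Fintype κ] in
/-- One row of the centre Jacobian entry lies in `jacRow`. [folklore] -/
theorem mem_jacRow_aux (prec : ℕ) {X : Array IntervalD} {x : ι → ℝ} (hx : ∀ i, IntervalD.mem (x i) (IntervalD.aget X (e i)))
    (j : ι) :
    ∀ {dl : List RTermD} {kl : List κ}, List.Forall₂ (fun d k => TermOK e d (Tc k) (Tt k)) dl kl →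
      IntervalD.mem ((kl.map fun k => (Tc k).coef * ((Tc k).fa.isCoord j * (Tc k).fb.val x +
        (Tc k).fa.val x * (Tc k).fb.isCoord j)).sum) (jacRow prec X (e j) dl)
  | _, _, List.Forall₂.nil => by simpa [jacRow] using IntervalD.mem_ofInt 0
  | _, _, List.Forall₂.cons (a := d) (b := k) h hl => by
    obtain ⟨hq, -, hfa, hfb⟩ := h
    obtain ⟨hac, -, -⟩ := mem_vals e hfa (X := X) hx
    obtain ⟨hbc, -, -⟩ := mem_vals e hfb (X := X) hx
    rw [List.map_cons, List.sum_cons, jacRow]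
    exact IntervalD.mem_addR prec (IntervalD.mem_mulR prec hq (IntervalD.mem_addR prec
      (IntervalD.mem_mulR prec (mem_isC e hfa j) hbc) (IntervalD.mem_mulR prec hac (mem_isC e hfb j))))
      (mem_jacRow_aux prec hx j hl)

omit [Fintype ι] in
/-- **THE CENTRE JACOBIAN OVER A BOX**: `jacEntry Tc x i j ∈ jacRow prec X (e j) (rrow RD (e i))` for `x` in the box
— the `dg`/`R` data of parts XVI/XVII/XXIX (`hi`, `mag`). [cite: Moore1979, §3.2; cell vocabulary, harvest/h2-tao-ladder rung1/KERNEL-CHEAP-REPLAY-SPEC.md §2 (d) (Ā ≥ |Df| on U′)] -/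
theorem mem_jacEntry_jacRow {rows : ι → List κ} {RD : RRows} (h : IsRTEncl e Tc Tt rows RD) (prec : ℕ)
    {X : Array IntervalD} {x : ι → ℝ} (hx : ∀ i, IntervalD.mem (x i) (IntervalD.aget X (e i))) (i j : ι) :
    IntervalD.mem (jacEntry Tc x i j) (jacRow prec X (e j) (rrow RD (e i))) := by
  obtain ⟨hrows, -, hdata⟩ := h
  rw [jacEntry, hrows i]
  exact mem_jacRow_aux e prec hx j (hdata i)

end RowSound

end DSSOneShift

end Summit.NavierStokesRegularity.NavierStokesRegularity.Theorems
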